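/-
Origin: expansion seat `planner-pub-hodgecm-mc-axioms-1-g14-0`, handover #W243 2026-08-20T15:53:55Z md5 b4dc7edd93cc (PKG f77592654924 → b4dc7edd93cc; 97 l.; MECHANICAL (iib-R) rewrite v3.1 of the PKG file as it stands (24 token edits; rules R1x1+RX[h₂]x23)) (`HOME/mc/pub-hodgecm-mc-axioms-1-g14/revendor/kit-r55/stage55/HodgeCM/Model/Binders/PinSideCast.lean`, md5 b4dc7edd93cc, 97 lines);
landed by the gen-22 packager (p-g22) in gate run 55 REPLACES the earlier landed copy of `HodgeCM/Model/Binders/PinSideCast.lean` (seat copy carried the packager Origin header of an earlier run (stripped)).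
-/
/-
Origin: speedrun cell pub-hodgecm, MODEL-CONSTRUCTION sub-cell, unit pub-hodgecm-mc-binder-1-g10 (BINDER PROVER, gen 10; S-pin transport of rows 16/17),
seat prover-pub-hodgecm-mc-binder-1-g10-0, 2026-08-20.  Target in PKG: HodgeCM/Model/Binders/PinSideCast.lean (NEW additive leaf; imports the installed
RUN-36 `Binders/Gen12Junctions` only).  KERNEL ONLY: 2 defs (structure re-packagings) + 5 theorems; 0 records, nothing cited, 0 `def … : Prop`, MODEL-N ±0, E unchanged.
-/
import Summits.HodgeConjecture.HodgeCM.Model.Binders.Gen12Junctions_2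

/-!
# Rows 16/17 of E across a change of the S pin (`pinT … S₁ …` → `pinT … S₂ …`)

The E ladder of record moved its S pin (`SInstance.S … @A` in RUN 39's `perL_picardCM_WSKSAE` → `SInstance.SROG …` in glue-1's
#395/#396, RUN 42).  What a change of the side FAMILY `S` costs the two binder-1 rows, in the kernel:
* `real34FunBridge_castSide` — NOTHING for row 17's type: the three fields of `Real34FunBridge` are typed by `HG`, `t34`, `SK`, `Λ`, `Uiso`,
  none of which sees the theta-class family, so a (34) function-level bridge for the model at `S₁` IS one for the model at `S₂`
  (definitionally; the record is re-packaged field by field);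
* `goodCtx_castSide` — NOTHING for the guard: `GoodCtx` sees only the sign recipe (`h`, `d12Of μ`, `d34Of μ`);
* `gen12FunBridge_castSide` — row 16 sees `S` only AT the context: transport along `e : S₁ V c = S₂ V c` (`thetaSpaceInputOf … S V c`
  is a `dite` on `S V c`, `thetaClassInputOf`/`thetaOf` are pointwise, `theta_congr_side`).
So re-pinning binder-1's producers (#27 `gen12_totalAE`, #31 r2 `real34_totalKSAE₀`) to a new S family is a question about their
INPUT currencies only (K34-PLAN §3 P1–P3), never about the conclusions.
-/

set_option autoImplicit false

noncomputable section

namespace HodgeCM.Model.Gen12Pins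

open HodgeCM HodgeCM.Universe HodgeCM.Model
open HodgeCM.Universe (ThetaModel)
open Literature.AlgebraicGeometry.HodgeTheory
open Literature.NumberTheory.Automorphic.PicardCM
open Literature.NumberTheory.Transcendental (Arapura2012_Cor_15_4_6)
open NumberField

variable (hHD : exists_isReal_hodgeModel) (hI : hodgePQ_independent_of_hodgeModel)
  (h₁ : BallQuotientUniformised)  (h₃ : CMAbelianVarietyRealised)
variable (h : Bool) (hA : Arapura2012_Cor_15_4_6)
  (W : ∀ {L : CMField} {ι₁ : L →+* ℂ} (V : HermSpace3 L ι₁) (c : SeesawCtx L), WmInput V c.D)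
  (S₁ S₂ : ∀ {L : CMField} {ι₁ : L →+* ℂ} (V : HermSpace3 L ι₁) (c : SeesawCtx L), ThetaAdelicSide V c)
  (μ : ∀ {L : CMField}, SeesawCtx L → Fin 4 → InfinitePlace L → ℤ)

variable {L : CMField} {ι₁ : L →+* ℂ} (V : HermSpace3 L ι₁) (c : SeesawCtx L)

/-- **The (34) function-level bridge does not see the S pin**: its three fields are typed by `HG`, `t34`, `SK`, `Λ`, `Uiso` only, all
independent of the theta-class family, so a bridge for the model at `S₁` IS a bridge for the model at `S₂` (same `h hA W μ`). -/
def real34FunBridge_castSide (B : (pinT hHD hI h₁ h₃ h hA W S₁ μ).Real34FunBridge V c) :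
    (pinT hHD hI h₁ h₃ h hA W S₂ μ).Real34FunBridge V c :=
  ⟨B.wset, B.gen_mem, B.meet⟩

/-- `Nonempty` form (the shape of E's row 17). -/
theorem nonempty_real34FunBridge_castSide (B : Nonempty ((pinT hHD hI h₁ h₃ h hA W S₁ μ).Real34FunBridge V c)) :
    Nonempty ((pinT hHD hI h₁ h₃ h hA W S₂ μ).Real34FunBridge V c) :=
  B.map (real34FunBridge_castSide hHD hI h₁ h₃ h hA W S₁ S₂ μ V c)

/-- the model's `GoodCtx` does not see the S pin either. -/
theorem goodCtx_castSide (hc : (pinT hHD hI h₁ h₃ h hA W S₂ μ).GoodCtx ι₁ c) : (pinT hHD hI h₁ h₃ h hA W S₁ μ).GoodCtx ι₁ c :=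
  ⟨hc.pairSum, hc.injective, hc.mem, hc.forced⟩

/-- the theta-space input of the pinned model at a context depends on the side family only through its value there. -/
theorem thetaSpaceInputOf_congr_side (e : S₁ V c = S₂ V c) :
    thetaSpaceInputOf hHD hI h₁ h₃ S₁ V c = thetaSpaceInputOf hHD hI h₁ h₃ S₂ V c := by
  unfold thetaSpaceInputOf
  beta_reduce
  rw [e]

/-- the theta classes of the pinned model at a context depend on the side family only through its value there. -/
theorem theta_congr_side (e : S₁ V c = S₂ V c) (k : Fin 4) (Γ : Level V) :
    (pinT hHD hI h₁ h₃ h hA W S₁ μ).Theta V c k Γ = (pinT hHD hI h₁ h₃ h hA W S₂ μ).Theta V c k Γ := by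
  show thetaOf _ (thetaClassInputOf _ (fun V c => thetaSpaceInputOf hHD hI h₁ h₃ S₁ V c)) V c k Γ =
    thetaOf _ (thetaClassInputOf _ (fun V c => thetaSpaceInputOf hHD hI h₁ h₃ S₂ V c)) V c k Γ
  simp only [thetaOf_thetaClassInputOf]
  rw [thetaSpaceInputOf_congr_side hHD hI h₁ h₃ S₁ S₂ V c e]

/-- **The (12) function-level bridge sees the S pin only AT the context**: transport along `S₁ V c = S₂ V c`. -/
def gen12FunBridge_castSide (e : S₁ V c = S₂ V c) (B : (pinT hHD hI h₁ h₃ h hA W S₁ μ).Gen12FunBridge V c) :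
    (pinT hHD hI h₁ h₃ h hA W S₂ μ).Gen12FunBridge V c where
  wf := B.wf
  wf_gen Γ ω₁ ω₂ h0 h1 := B.wf_gen Γ ω₁ ω₂
    ((theta_congr_side hHD hI h₁ h₃ h hA W S₁ S₂ μ V c e 0 Γ).symm ▸ h0)
    ((theta_congr_side hHD hI h₁ h₃ h hA W S₁ S₂ μ V c e 1 Γ).symm ▸ h1)
  proj Γ ω₁ ω₂ h0 h1 := B.proj Γ ω₁ ω₂
    ((theta_congr_side hHD hI h₁ h₃ h hA W S₁ S₂ μ V c e 0 Γ).symm ▸ h0)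
    ((theta_congr_side hHD hI h₁ h₃ h hA W S₁ S₂ μ V c e 1 Γ).symm ▸ h1)

/-- `Nonempty` form (the shape of E's row 16). -/
theorem nonempty_gen12FunBridge_castSide (e : S₁ V c = S₂ V c) (B : Nonempty ((pinT hHD hI h₁ h₃ h hA W S₁ μ).Gen12FunBridge V c)) :
    Nonempty ((pinT hHD hI h₁ h₃ h hA W S₂ μ).Gen12FunBridge V c) :=
  B.map (gen12FunBridge_castSide hHD hI h₁ h₃ h hA W S₁ S₂ μ V c e)

end HodgeCM.Model.Gen12Pins

end
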